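import Literature.NumberTheory.Automorphic.KimSymmetricFourthGL2Proofs
import Literature.NumberTheory.LFunctions.SelbergClassUniformConvexity
import HarnessLib

/-!
# KimSymmetricFourthGL2Reduction — the analytic half of `Kim2003_symmFourL_nonCM_entire_polyBound`

The named fact `Literature.NumberTheory.Automorphic.Kim2003_symmFourL_nonCM_entire_polyBound`
(`KimSymmetricFourthGL2.lean`) asserts, for the newform `f` of a non-CM elliptic curve `W/ℚ` of
level `N`, that the good-prime symmetric fourth power Euler product `L^{(N)}(s, Sym⁴ E)` is the
restriction of an ENTIRE function bounded by `C · N^K` on the disc `|s - 2| ≤ 3/2`. In print this is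
(automorphic input) Kim's functoriality `Sym⁴ : GL₂ → GL₅` with the Kim–Shahidi cuspidality
criterion and the Godement–Jacquet theory, which put `L(s, Sym⁴ E)` in the Selberg class with an
explicit gamma factor and a conductor `≤ N^{O(1)}`, followed by (analytic half) the
Phragmén–Lindelöf convexity bound in the conductor aspect and the trivial bound for the finitely
many inverted local factors at `p ∣ N` [IwaniecKowalski2004, §5.2].

This file PROVES the analytic half, reducing the fact to its automorphic input stated in the
tree's classical vocabulary (`Literature.NumberTheory.LFunctions.SelbergDatum`):

* `symmFourLogEulerTerm N f p k s` — the summand of the good-prime log-Euler series (verbatim the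
  summand of the fact), and `IsSymmFourSelbergDatum N f D` — "`D` is a Selberg datum for
  `L(s, Sym⁴ f)`": no pole, and on `Re s > 1` its function is
  `exp (∑_{p ∤ N} ∑_k …) × ∏_{p ∣ N} ∏_{j < 5} (1 - β_{p,j} p^{-s})⁻¹` with `|β_{p,j}| ≤ 1`
  (the shape of the ramified local factors of a unitary `GL₅` `L`-function satisfying the trivial
  bound towards Ramanujan).
* `Kim2003_symmFourL_nonCM_entire_polyBound_of_selbergData` — **the reduction**: if for every
  non-CM `W` with newform `f` of level `N` there is such a datum with gamma data in a fixed bounded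
  family (`numGamma ≤ n`, `λ₀ ≤ λⱼ ≤ Λ₀`, `‖μⱼ‖ ≤ M₀`) and `Q ≤ c₁ N^{c₂}`, then the fact holds.
  Ingredients, all proved: the universal bound `‖F(s)‖ ≤ A₀` on `Re s ≥ 3/2` (Hasse ⇒ `|T₄| ≤ 5`,
  `norm_tsum_symmFourLogEulerTerm_le`; bad factors `≤ exp (10 ∑ n^{-3/2})`,
  `norm_prod_inv_badFactor_le`), the uniform convexity bound
  `SelbergDatum.exists_uniform_norm_pow_mul_toFun_le` (`SelbergClassUniformConvexity.lean`), the
  bound `∏_{p ∣ N} ∏_j |1 - β p^{-s}| ≤ 2^{5ω(N)} ≤ N⁵` on `Re s ≥ 1/2` (`norm_prod_badFactor_le`),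
  and continuity at `s = 1`.

What remains for `Kim2003_symmFourL_nonCM_entire_polyBound_holds` is exactly the hypothesis of the
reduction: membership of `L(s, Sym⁴ E)` (non-CM `E/ℚ`) in the Selberg class with no pole, gamma
factor `Γ_ℝ(s) Γ_ℂ(s+1) Γ_ℂ(s+2)` and conductor `≤ N^{O(1)}` — Kim 2003 Thm. B, Kim–Shahidi 2002
(Duke 112) Thm. 3.3.7 / Prop. 3.3.8, Godement–Jacquet, Cogdell–Michel 2004 §1 for the archimedean
data; an XL automorphic input absent from the tree (see `KimSymmetricFourthGL2Proofs` docstring).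
No new named facts are introduced (D-0026): the automorphic input is a HYPOTHESIS of the reduction
theorem, never asserted.

## References

* H. Iwaniec, E. Kowalski, *Analytic Number Theory*, AMS Colloq. Publ. 53 (2004), §5.2
  (5.20)–(5.21) and §5.1 (ramified local factors). [IwaniecKowalski2004]
* H. H. Kim, F. Shahidi, *Cuspidality of symmetric powers with applications*, Duke Math. J. 112
  (2002), 177–197, Thm. 3.3.7, Prop. 3.3.8, §4. [KimShahidiCusp2002]
* H. H. Kim, *Functoriality for the exterior square of `GL₄` and the symmetric fourth of `GL₂`*,
  J. Amer. Math. Soc. 16 (2003), 139–183, Thm. B. [Kim2003]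
-/

noncomputable section

namespace Literature.NumberTheory.Automorphic

open scoped Real _root_.Topology
open Set Filter Metric Complex CongruenceSubgroup
open Literature.NumberTheory.EllipticCurves.ModularForms
open Literature.NumberTheory.LFunctions

/-! ### The good-prime log-Euler series and the predicate "Selberg datum for `L(s, Sym⁴ f)`" -/

/-- The summand `c(p, k) p^{-(k+1)s}` of the good-prime symmetric fourth power log-Euler series of
`f ∈ S₂(Γ₀(N))`: `c(p, k) = T₄(C_{k+1}(Re a_p(f)/√p))/(k+1)` for `p ∤ N` (`T₄(x) = x⁴ - 3x² + 1`,
`C_{k+1}` the Chebyshev polynomial with `C_{k+1}(2 cos θ) = 2 cos (k+1)θ`) and `0` for `p ∣ N` —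
verbatim the summand of `Kim2003_symmFourL_nonCM_entire_polyBound`, so that
`L^{(N)}(s, Sym⁴ f) = exp (∑_p ∑_k symmFourLogEulerTerm N f p k s)` on `Re s > 1`.
[cite: KimShahidiCusp2002, §4 p. 194] -/
def symmFourLogEulerTerm (N : ℕ) (f : CuspForm (Gamma0 N) 2) (p : Nat.Primes) (k : ℕ) (s : ℂ) : ℂ :=
  ((if ¬ (p : ℕ) ∣ N then
        (((Polynomial.Chebyshev.C ℝ (k + 1)).eval ((cuspCoeff f p).re / Real.sqrt p)) ^ 4 -
          3 * ((Polynomial.Chebyshev.C ℝ (k + 1)).eval ((cuspCoeff f p).re / Real.sqrt p)) ^ 2 +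
            1) / (k + 1)
      else 0 : ℝ) : ℂ) * (p : ℂ) ^ (-((k + 1 : ℕ) : ℂ) * s)

/-- Unfolding of `symmFourLogEulerTerm`. [folklore] -/
theorem symmFourLogEulerTerm_def (N : ℕ) (f : CuspForm (Gamma0 N) 2) (p : Nat.Primes) (k : ℕ)
    (s : ℂ) : symmFourLogEulerTerm N f p k s =
      ((if ¬ (p : ℕ) ∣ N then
          (((Polynomial.Chebyshev.C ℝ (k + 1)).eval ((cuspCoeff f p).re / Real.sqrt p)) ^ 4 -
            3 * ((Polynomial.Chebyshev.C ℝ (k + 1)).eval ((cuspCoeff f p).re / Real.sqrt p)) ^ 2 +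
              1) / (k + 1)
        else 0 : ℝ) : ℂ) * (p : ℂ) ^ (-((k + 1 : ℕ) : ℂ) * s) := rfl

/-- **"`D` is a Selberg datum for `L(s, Sym⁴ f)`"** (`f ∈ S₂(Γ₀(N))`, analytic normalisation):
`D` has no pole (`polarOrder = 0`) and on `Re s > 1` its function is the good-prime symmetric
fourth power Euler product of `f` times, at each prime `p ∣ N`, at most five inverse linear local
factors `(1 - β_{p,j} p^{-s})⁻¹` with `|β_{p,j}| ≤ 1` — the shape of the ramified local factors of
the standard `L`-function of a unitary automorphic representation of `GL₅` under the trivial bound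
towards Ramanujan (Iwaniec–Kowalski §5.1, (5.3) with `|α_j(p)| ≤ 1`; for `Sym⁴ π_E` this is
Kim 2003 Thm. B with the local Langlands correspondence at `p ∣ N`). A predicate on data, not an
assertion. [cite: IwaniecKowalski2004, §5.1 (5.1)–(5.3)] -/
def IsSymmFourSelbergDatum (N : ℕ) (f : CuspForm (Gamma0 N) 2) (D : SelbergDatum) : Prop :=
  D.polarOrder = 0 ∧
    ∃ β : ℕ → Fin 5 → ℂ, (∀ p j, ‖β p j‖ ≤ 1) ∧
      ∀ s : ℂ, 1 < s.re →
        D.toFun s = cexp (∑' p : Nat.Primes, ∑' k : ℕ, symmFourLogEulerTerm N f p k s) *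
          ∏ p ∈ N.primeFactors, ∏ j : Fin 5, (1 - β p j * (p : ℂ) ^ (-s))⁻¹

/-! ### The universal bound on `Re s ≥ 3/2` -/

/-- `|c(p, k)| ≤ 5` for the log-Euler coefficients of the newform of an elliptic curve (Hasse:
`|a_p/√p| ≤ 2`, so `|C_{k+1}| ≤ 2` and `|T₄| ≤ 5`, and `k + 1 ≥ 1`). [cite: SilvermanAEC2009, Thm. V.1.1] -/
theorem abs_symmFourLogEulerCoeff_le_five {N : ℕ} [NeZero N] (W : WeierstrassCurve ℚ) [W.IsElliptic]
    {f : CuspForm (Gamma0 N) 2} (hf : IsNewformOf W f) (p : Nat.Primes) (k : ℕ) :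
    |(if ¬ (p : ℕ) ∣ N then
        (((Polynomial.Chebyshev.C ℝ (k + 1)).eval ((cuspCoeff f p).re / Real.sqrt p)) ^ 4 -
          3 * ((Polynomial.Chebyshev.C ℝ (k + 1)).eval ((cuspCoeff f p).re / Real.sqrt p)) ^ 2 +
            1) / (k + 1)
      else 0 : ℝ)| ≤ 5 := by
  split_ifs with h
  · simp
  · have hx := abs_cuspCoeff_re_div_sqrt_le_two_of_isNewformOf W hf p.2
    have hT := abs_symmFourTrace_le_five (SymmSqLogEuler.abs_chebyshevC_eval_le hx (k + 1))
    rw [abs_div, abs_of_pos (by positivity : (0 : ℝ) < k + 1), div_le_iff₀ (by positivity)]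
    have hk : (0 : ℝ) ≤ k := Nat.cast_nonneg k
    nlinarith [abs_nonneg ((((Polynomial.Chebyshev.C ℝ (k + 1)).eval
      ((cuspCoeff f p).re / Real.sqrt p)) ^ 4 -
        3 * ((Polynomial.Chebyshev.C ℝ (k + 1)).eval ((cuspCoeff f p).re / Real.sqrt p)) ^ 2 + 1))]

/-- Termwise majorant: for `σ₀ ≤ Re s`, `‖c(p,k) p^{-(k+1)s}‖ ≤ ‖5 · p^{-(k+1)σ₀}‖`. [folklore] -/
theorem norm_symmFourLogEulerTerm_le {N : ℕ} [NeZero N] (W : WeierstrassCurve ℚ) [W.IsElliptic]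
    {f : CuspForm (Gamma0 N) 2} (hf : IsNewformOf W f) (p : Nat.Primes) (k : ℕ) {s : ℂ} {σ₀ : ℝ}
    (hs : σ₀ ≤ s.re) :
    ‖symmFourLogEulerTerm N f p k s‖ ≤
      ‖((5 : ℝ) : ℂ) * (p : ℂ) ^ (-((k + 1 : ℕ) : ℂ) * (σ₀ : ℂ))‖ := by
  have hp : 0 < ((p : ℕ) : ℝ) := by exact_mod_cast p.2.pos
  have hp1 : (1 : ℝ) ≤ ((p : ℕ) : ℝ) := by exact_mod_cast p.2.one_lt.le
  rw [symmFourLogEulerTerm_def, norm_mul, norm_mul, Complex.norm_real, Complex.norm_real,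
    Real.norm_eq_abs, Real.norm_eq_abs, Complex.norm_natCast_cpow_of_pos p.2.pos,
    Complex.norm_natCast_cpow_of_pos p.2.pos]
  have hre1 : (-((k + 1 : ℕ) : ℂ) * s).re = (-s.re) * ((k + 1 : ℕ) : ℝ) := by
    simp [Complex.mul_re]; ring
  have hre2 : (-((k + 1 : ℕ) : ℂ) * (σ₀ : ℂ)).re = (-σ₀) * ((k + 1 : ℕ) : ℝ) := by
    simp [Complex.mul_re]; ring
  rw [hre1, hre2, abs_of_pos (by norm_num : (0 : ℝ) < 5)]
  have hk0 : (0 : ℝ) < ((k + 1 : ℕ) : ℝ) := by positivity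
  have hexp : (-s.re) * ((k + 1 : ℕ) : ℝ) ≤ (-σ₀) * ((k + 1 : ℕ) : ℝ) := by nlinarith
  have h1 : ((p : ℕ) : ℝ) ^ ((-s.re) * ((k + 1 : ℕ) : ℝ)) ≤
      ((p : ℕ) : ℝ) ^ ((-σ₀) * ((k + 1 : ℕ) : ℝ)) :=
    Real.rpow_le_rpow_of_exponent_le hp1 hexp
  exact mul_le_mul (abs_symmFourLogEulerCoeff_le_five W hf p k) h1 (Real.rpow_nonneg hp.le _)
    (by norm_num)

/-- **Universal majorant for the good-prime log-Euler series on `Re s ≥ 3/2`**: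
`‖∑_p ∑_k c(p,k) p^{-(k+1)s}‖ ≤ S₀ := ∑_p ∑_k 5 p^{-3(k+1)/2}`, a constant independent of `f`,
`N` and `s`. [folklore] -/
theorem norm_tsum_symmFourLogEulerTerm_le {N : ℕ} [NeZero N] (W : WeierstrassCurve ℚ)
    [W.IsElliptic] {f : CuspForm (Gamma0 N) 2} (hf : IsNewformOf W f) {s : ℂ} (hs : 3 / 2 ≤ s.re) :
    ‖∑' p : Nat.Primes, ∑' k : ℕ, symmFourLogEulerTerm N f p k s‖ ≤
      ∑' p : Nat.Primes, ∑' k : ℕ,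
        ‖((5 : ℝ) : ℂ) * (p : ℂ) ^ (-((k + 1 : ℕ) : ℂ) * (((3 / 2 : ℝ) : ℂ)))‖ := by
  have hs1 : 1 < s.re := by linarith
  have h32 : (1 : ℝ) < (((3 / 2 : ℝ) : ℂ)).re := by
    rw [Complex.ofReal_re]; norm_num
  have hsum := Kim2003_symmFourL_nonCM_entire_polyBound.summable_logEuler N W f hf s hs1
  have hin : ∀ p : Nat.Primes, Summable fun k : ℕ ↦ ‖symmFourLogEulerTerm N f p k s‖ := hsum.1
  have hout : Summable fun p : Nat.Primes ↦ ∑' k : ℕ, ‖symmFourLogEulerTerm N f p k s‖ := hsum.2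
  have hmaj := summable_norm_mul_primePow_cpow (c := fun _ _ ↦ (5 : ℝ)) (B := 5)
    (fun _ _ ↦ by norm_num) h32
  have hout' : Summable fun p : Nat.Primes ↦ ‖∑' k : ℕ, symmFourLogEulerTerm N f p k s‖ :=
    Summable.of_nonneg_of_le (fun _ ↦ norm_nonneg _) (fun p ↦ norm_tsum_le_tsum_norm (hin p)) hout
  calc ‖∑' p : Nat.Primes, ∑' k : ℕ, symmFourLogEulerTerm N f p k s‖
      ≤ ∑' p : Nat.Primes, ‖∑' k : ℕ, symmFourLogEulerTerm N f p k s‖ := norm_tsum_le_tsum_norm hout'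
    _ ≤ ∑' p : Nat.Primes, ∑' k : ℕ, ‖symmFourLogEulerTerm N f p k s‖ :=
        Summable.tsum_le_tsum (fun p ↦ norm_tsum_le_tsum_norm (hin p)) hout' hout
    _ ≤ ∑' p : Nat.Primes, ∑' k : ℕ,
          ‖((5 : ℝ) : ℂ) * (p : ℂ) ^ (-((k + 1 : ℕ) : ℂ) * (((3 / 2 : ℝ) : ℂ)))‖ :=
        Summable.tsum_le_tsum (fun p ↦ Summable.tsum_le_tsum
          (fun k ↦ norm_symmFourLogEulerTerm_le W hf p k hs) (hin p) (hmaj.1 p)) hout hmaj.2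

/-- `‖(1 - z)⁻¹‖ ≤ exp (2‖z‖)` for `‖z‖ ≤ 1/2`. [folklore] -/
theorem norm_inv_one_sub_le_exp {z : ℂ} (hz : ‖z‖ ≤ 1 / 2) : ‖(1 - z)⁻¹‖ ≤ Real.exp (2 * ‖z‖) := by
  have h1 : 1 - ‖z‖ ≤ ‖1 - z‖ := by
    have := norm_sub_norm_le (1 : ℂ) z
    rwa [norm_one] at this
  have hpos : 0 < 1 - ‖z‖ := by linarith
  have hz0 := norm_nonneg z
  rw [norm_inv]
  calc ‖1 - z‖⁻¹ ≤ (1 - ‖z‖)⁻¹ := inv_anti₀ hpos h1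
    _ ≤ 1 + 2 * ‖z‖ := by
        rw [inv_eq_one_div, div_le_iff₀ hpos]
        nlinarith
    _ ≤ Real.exp (2 * ‖z‖) := by linarith [Real.add_one_le_exp (2 * ‖z‖)]

/-- `‖β p^{-s}‖ ≤ p^{-σ₀}` for `|β| ≤ 1`, `σ₀ ≤ Re s`. [folklore] -/
theorem norm_mul_natCast_cpow_neg_le {β : ℂ} (hβ : ‖β‖ ≤ 1) {p : ℕ} (hp : 0 < p) {s : ℂ} {σ₀ : ℝ}
    (hs : σ₀ ≤ s.re) : ‖β * (p : ℂ) ^ (-s)‖ ≤ (p : ℝ) ^ (-σ₀) := by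
  rw [norm_mul, Complex.norm_natCast_cpow_of_pos hp, Complex.neg_re]
  have hp1 : (1 : ℝ) ≤ p := by exact_mod_cast hp
  have h0 : 0 ≤ (p : ℝ) ^ (-s.re) := Real.rpow_nonneg (by positivity) _
  calc ‖β‖ * (p : ℝ) ^ (-s.re) ≤ 1 * (p : ℝ) ^ (-s.re) := mul_le_mul_of_nonneg_right hβ h0
    _ ≤ (p : ℝ) ^ (-σ₀) := by
        rw [one_mul]; exact Real.rpow_le_rpow_of_exponent_le hp1 (by linarith)

/-- **The inverted bad factors are uniformly bounded on `Re s ≥ 3/2`**: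
`∏_{p ∣ N} ∏_{j<5} ‖(1 - β_{p,j} p^{-s})⁻¹‖ ≤ exp (10 ∑_n n^{-3/2})`, independently of `N`.
[folklore] -/
theorem norm_prod_inv_badFactor_le (N : ℕ) {β : ℕ → Fin 5 → ℂ} (hβ : ∀ p j, ‖β p j‖ ≤ 1) {s : ℂ}
    (hs : 3 / 2 ≤ s.re) :
    ‖∏ p ∈ N.primeFactors, ∏ j : Fin 5, (1 - β p j * (p : ℂ) ^ (-s))⁻¹‖ ≤
      Real.exp (10 * ∑' n : ℕ, (n : ℝ) ^ (-(3 / 2 : ℝ))) := by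
  have hsum : Summable fun n : ℕ ↦ (n : ℝ) ^ (-(3 / 2 : ℝ)) :=
    Real.summable_nat_rpow.mpr (by norm_num)
  have hhalf : ∀ p ∈ N.primeFactors, (p : ℝ) ^ (-(3 / 2 : ℝ)) ≤ 1 / 2 := by
    intro p hp
    have hp2 : (2 : ℝ) ≤ p := by exact_mod_cast (Nat.prime_of_mem_primeFactors hp).two_le
    calc (p : ℝ) ^ (-(3 / 2 : ℝ)) ≤ (2 : ℝ) ^ (-(3 / 2 : ℝ)) :=
          Real.rpow_le_rpow_of_nonpos (by norm_num) hp2 (by norm_num)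
      _ ≤ (2 : ℝ) ^ (-1 : ℝ) := Real.rpow_le_rpow_of_exponent_le (by norm_num) (by norm_num)
      _ = 1 / 2 := by rw [Real.rpow_neg_one]; norm_num
  have hfac : ∀ p ∈ N.primeFactors, ∀ j : Fin 5,
      ‖(1 - β p j * (p : ℂ) ^ (-s))⁻¹‖ ≤ Real.exp (2 * (p : ℝ) ^ (-(3 / 2 : ℝ))) := by
    intro p hp j
    have hpr := Nat.prime_of_mem_primeFactors hp
    have hz : ‖β p j * (p : ℂ) ^ (-s)‖ ≤ (p : ℝ) ^ (-(3 / 2 : ℝ)) :=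
      norm_mul_natCast_cpow_neg_le (hβ p j) hpr.pos hs
    exact (norm_inv_one_sub_le_exp (hz.trans (hhalf p hp))).trans
      (Real.exp_le_exp.mpr (by linarith))
  calc ‖∏ p ∈ N.primeFactors, ∏ j : Fin 5, (1 - β p j * (p : ℂ) ^ (-s))⁻¹‖
      = ∏ p ∈ N.primeFactors, ∏ j : Fin 5, ‖(1 - β p j * (p : ℂ) ^ (-s))⁻¹‖ := by
        rw [norm_prod]; exact Finset.prod_congr rfl fun p _ ↦ norm_prod _ _
    _ ≤ ∏ p ∈ N.primeFactors, ∏ _j : Fin 5, Real.exp (2 * (p : ℝ) ^ (-(3 / 2 : ℝ))) :=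
        Finset.prod_le_prod (fun p _ ↦ Finset.prod_nonneg fun j _ ↦ norm_nonneg _)
          (fun p hp ↦ Finset.prod_le_prod (fun j _ ↦ norm_nonneg _) (fun j _ ↦ hfac p hp j))
    _ = Real.exp (∑ p ∈ N.primeFactors, 10 * (p : ℝ) ^ (-(3 / 2 : ℝ))) := by
        rw [Real.exp_sum]
        refine Finset.prod_congr rfl fun p _ ↦ ?_
        rw [Finset.prod_const, Finset.card_univ, Fintype.card_fin, ← Real.exp_nat_mul]
        congr 1; push_cast; ring
    _ ≤ Real.exp (10 * ∑' n : ℕ, (n : ℝ) ^ (-(3 / 2 : ℝ))) := by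
        apply Real.exp_le_exp.mpr
        rw [← Finset.mul_sum]
        refine mul_le_mul_of_nonneg_left ?_ (by norm_num)
        exact Summable.sum_le_tsum _ (fun n _ ↦ Real.rpow_nonneg (Nat.cast_nonneg n) _) hsum

/-! ### The bad factors on `Re s ≥ 1/2` -/

/-- `1 - β p^{-s} ≠ 0` for `|β| ≤ 1`, `p` prime, `Re s > 0`. [folklore] -/
theorem one_sub_badFactor_ne_zero {β : ℂ} (hβ : ‖β‖ ≤ 1) {p : ℕ} (hp : p.Prime) {s : ℂ}
    (hs : 0 < s.re) : 1 - β * (p : ℂ) ^ (-s) ≠ 0 := by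
  intro h
  have h1 : β * (p : ℂ) ^ (-s) = 1 := (sub_eq_zero.mp h).symm
  have h2 : ‖β * (p : ℂ) ^ (-s)‖ < 1 := by
    rw [norm_mul, Complex.norm_natCast_cpow_of_pos hp.pos, Complex.neg_re]
    have hp2 : (1 : ℝ) < p := by exact_mod_cast hp.one_lt
    have hlt : (p : ℝ) ^ (-s.re) < 1 := Real.rpow_lt_one_of_one_lt_of_neg hp2 (by linarith)
    have h0 : 0 ≤ (p : ℝ) ^ (-s.re) := Real.rpow_nonneg (by positivity) _
    calc ‖β‖ * (p : ℝ) ^ (-s.re) ≤ 1 * (p : ℝ) ^ (-s.re) := mul_le_mul_of_nonneg_right hβ h0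
      _ < 1 := by rw [one_mul]; exact hlt
  rw [h1, norm_one] at h2
  exact lt_irrefl _ h2

/-- **The bad factors are at most `N⁵` on `Re s ≥ 1/2`**: each `|1 - β p^{-s}| ≤ 2`, so the product
over `p ∣ N`, `j < 5` is `≤ ∏_{p ∣ N} 2⁵ ≤ ∏_{p ∣ N} p⁵ ≤ N⁵`. [folklore] -/
theorem norm_prod_badFactor_le (N : ℕ) (hN : N ≠ 0) {β : ℕ → Fin 5 → ℂ} (hβ : ∀ p j, ‖β p j‖ ≤ 1)
    {s : ℂ} (hs : 1 / 2 ≤ s.re) :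
    ‖∏ p ∈ N.primeFactors, ∏ j : Fin 5, (1 - β p j * (p : ℂ) ^ (-s))‖ ≤ (N : ℝ) ^ 5 := by
  have hfac : ∀ p ∈ N.primeFactors, ∀ j : Fin 5, ‖1 - β p j * (p : ℂ) ^ (-s)‖ ≤ 2 := by
    intro p hp j
    have hpr := Nat.prime_of_mem_primeFactors hp
    have hp1 : (1 : ℝ) ≤ p := by exact_mod_cast hpr.one_lt.le
    have hz : ‖β p j * (p : ℂ) ^ (-s)‖ ≤ (p : ℝ) ^ (-(1 / 2 : ℝ)) :=
      norm_mul_natCast_cpow_neg_le (hβ p j) hpr.pos hs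
    have hz1 : (p : ℝ) ^ (-(1 / 2 : ℝ)) ≤ 1 := Real.rpow_le_one_of_one_le_of_nonpos hp1 (by norm_num)
    calc ‖1 - β p j * (p : ℂ) ^ (-s)‖ ≤ ‖(1 : ℂ)‖ + ‖β p j * (p : ℂ) ^ (-s)‖ := norm_sub_le _ _
      _ ≤ 1 + 1 := by rw [norm_one]; linarith [hz.trans hz1]
      _ = 2 := by norm_num
  have hrad : ((∏ p ∈ N.primeFactors, p : ℕ) : ℝ) ≤ N := by
    exact_mod_cast Nat.le_of_dvd (Nat.pos_of_ne_zero hN) (Nat.prod_primeFactors_dvd N)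
  calc ‖∏ p ∈ N.primeFactors, ∏ j : Fin 5, (1 - β p j * (p : ℂ) ^ (-s))‖
      = ∏ p ∈ N.primeFactors, ∏ j : Fin 5, ‖1 - β p j * (p : ℂ) ^ (-s)‖ := by
        rw [norm_prod]; exact Finset.prod_congr rfl fun p _ ↦ norm_prod _ _
    _ ≤ ∏ p ∈ N.primeFactors, ((p : ℝ)) ^ 5 := by
        refine Finset.prod_le_prod (fun p _ ↦ Finset.prod_nonneg fun j _ ↦ norm_nonneg _)
          (fun p hp ↦ ?_)
        have hp2 : (2 : ℝ) ≤ p := by exact_mod_cast (Nat.prime_of_mem_primeFactors hp).two_le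
        calc ∏ j : Fin 5, ‖1 - β p j * (p : ℂ) ^ (-s)‖ ≤ ∏ _j : Fin 5, (2 : ℝ) :=
              Finset.prod_le_prod (fun j _ ↦ norm_nonneg _) (fun j _ ↦ hfac p hp j)
          _ = 2 ^ 5 := by rw [Finset.prod_const, Finset.card_univ, Fintype.card_fin]
          _ ≤ (p : ℝ) ^ 5 := pow_le_pow_left₀ (by norm_num) hp2 5
    _ = ((∏ p ∈ N.primeFactors, p : ℕ) : ℝ) ^ 5 := by
        rw [Finset.prod_pow]; push_cast; rfl
    _ ≤ (N : ℝ) ^ 5 := pow_le_pow_left₀ (by positivity) hrad 5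

/-! ### The reduction theorem -/

set_option maxHeartbeats 800000 in
/-- **`Kim2003_symmFourL_nonCM_entire_polyBound` from the Selberg-class membership of
`L(s, Sym⁴ E)` with polynomial conductor (the analytic half of the printed proof, PROVED).**
Suppose that for every non-CM elliptic curve `W/ℚ` with newform `f` of level `N` there is a
Selberg datum `D` for `L(s, Sym⁴ f)` in the sense of `IsSymmFourSelbergDatum` whose gamma data lie
in a fixed bounded family (`numGamma ≤ n`, `λ₀ ≤ λⱼ ≤ Λ₀`, `‖μⱼ‖ ≤ M₀`) and whose parameter `Q`
is at most `c₁ N^{c₂}` — in print: `Sym⁴ π_E` is cuspidal automorphic on `GL₅(𝔸_ℚ)` for non-CM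
`E` (Kim 2003 Thm. B; Kim–Shahidi 2002 Thm. 3.3.7 / Prop. 3.3.8), its standard `L`-function is
entire of finite order with functional equation, gamma factor `Γ_ℝ(s)Γ_ℂ(s+1)Γ_ℂ(s+2)` and
conductor `≤ N^{O(1)}` (Godement–Jacquet; Cogdell–Michel 2004 §1; Rouse 2007 Lemma 2.1). Then the
fact holds: the entire function is `L₄ = F · ∏_{p ∣ N} ∏_j (1 - β_{p,j} p^{-s})`, equal to the
good-prime Euler product on `Re s > 1`; on the disc `|s - 2| ≤ 3/2` (`1/2 ≤ Re s ≤ 7/2`,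
`|Im s| ≤ 3/2`) the uniform convexity bound `SelbergDatum.exists_uniform_norm_pow_mul_toFun_le`
gives `‖F(s)‖ ≤ C max(1,Q)^A (5/2)^A ≤ C' N^{A c₂}` (the bound `A₀` on `Re s ≥ 3/2` being
universal by Hasse, `norm_tsum_symmFourLogEulerTerm_le`, `norm_prod_inv_badFactor_le`), extended
to `s = 1` by continuity, and the bad factors contribute `≤ N⁵` (`norm_prod_badFactor_le`).
[cite: IwaniecKowalski2004, §5.2 (5.20)–(5.21)] -/
theorem Kim2003_symmFourL_nonCM_entire_polyBound_of_selbergData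
    (h : ∃ (n : ℕ) (lam₀ Λ₀ M₀ c₁ c₂ : ℝ), 0 < lam₀ ∧
      ∀ (N : ℕ) [NeZero N] (W : WeierstrassCurve ℚ) [W.IsElliptic] (f : CuspForm (Gamma0 N) 2),
        IsNewformOf W f → ¬ W.HasCM →
        ∃ D : SelbergDatum, IsSymmFourSelbergDatum N f D ∧ D.numGamma ≤ n ∧
          (∀ j, lam₀ ≤ D.lam j ∧ D.lam j ≤ Λ₀ ∧ ‖D.mu j‖ ≤ M₀) ∧ D.Q ≤ c₁ * (N : ℝ) ^ c₂) :
    Kim2003_symmFourL_nonCM_entire_polyBound := by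
  obtain ⟨n, lam₀, Λ₀, M₀, c₁, c₂, hlam₀, hfam⟩ := h
  -- the universal bound on `Re s ≥ 3/2`
  set A₀ : ℝ := Real.exp (∑' p : Nat.Primes, ∑' k : ℕ,
      ‖((5 : ℝ) : ℂ) * (p : ℂ) ^ (-((k + 1 : ℕ) : ℂ) * (((3 / 2 : ℝ) : ℂ)))‖) *
    Real.exp (10 * ∑' m : ℕ, (m : ℝ) ^ (-(3 / 2 : ℝ))) with hA₀
  obtain ⟨C, A, hC, hA, hconv⟩ :=
    SelbergDatum.exists_uniform_norm_pow_mul_toFun_le n 0 hlam₀ Λ₀ M₀ A₀ (1 / 2) (7 / 2)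
  -- constants
  set c₁' : ℝ := max 1 c₁ with hc₁'
  have hc₁'1 : 1 ≤ c₁' := le_max_left _ _
  set c₂' : ℝ := max c₂ 0 with hc₂'
  have hc₂'0 : 0 ≤ c₂' := le_max_right _ _
  set Cfin : ℝ := max 1 (C * (5 / 2 : ℝ) ^ A * c₁' ^ A) with hCfin
  set Kfin : ℝ := A * c₂' + 5 with hKfin
  refine ⟨Cfin, Kfin, le_max_left _ _, by positivity, ?_⟩
  intro N _ W _ f hf hCM
  obtain ⟨D, ⟨hm0, β, hβ, hEuler⟩, hn, hshape, hQ⟩ := hfam N W f hf hCM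
  obtain ⟨G, hG, hGF⟩ := D.differentiable
  have hGF' : ∀ s, s ≠ 1 → G s = D.toFun s := fun s hs ↦ by
    rw [hGF s hs, hm0, pow_zero, one_mul]
  have hN0 : (N : ℕ) ≠ 0 := NeZero.ne N
  have hN1 : (1 : ℝ) ≤ N := by exact_mod_cast Nat.one_le_iff_ne_zero.mpr hN0
  have hN0' : (0 : ℝ) < N := by linarith
  -- `‖F‖ ≤ A₀` on `Re s ≥ 3/2`
  have hA₀D : ∀ s : ℂ, 3 / 2 ≤ s.re → ‖D.toFun s‖ ≤ A₀ := by
    intro s hs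
    rw [hEuler s (by linarith), norm_mul, hA₀]
    refine mul_le_mul ?_ (norm_prod_inv_badFactor_le N hβ hs) (norm_nonneg _) (Real.exp_pos _).le
    exact (Complex.norm_exp_le_exp_norm _).trans
      (Real.exp_le_exp.mpr (norm_tsum_symmFourLogEulerTerm_le W hf hs))
  -- the uniform convexity bound for this datum on `1/2 ≤ Re s ≤ 7/2`
  have hconvD := hconv D hn hm0.le (fun j ↦ (hshape j).1) (fun j ↦ (hshape j).2.1)
    (fun j ↦ (hshape j).2.2) hA₀D
  -- `max(1, Q) ≤ c₁' N^{c₂'}`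
  have hNc : (1 : ℝ) ≤ (N : ℝ) ^ c₂' := Real.one_le_rpow hN1 hc₂'0
  have hmax : max 1 D.Q ≤ c₁' * (N : ℝ) ^ c₂' := by
    refine max_le (one_le_mul_of_one_le_of_one_le hc₁'1 hNc) (hQ.trans ?_)
    have h1 : (N : ℝ) ^ c₂ ≤ (N : ℝ) ^ c₂' := Real.rpow_le_rpow_of_exponent_le hN1 (le_max_left _ _)
    have h2 : 0 ≤ (N : ℝ) ^ c₂ := Real.rpow_nonneg hN0'.le _
    calc c₁ * (N : ℝ) ^ c₂ ≤ c₁' * (N : ℝ) ^ c₂ := mul_le_mul_of_nonneg_right (le_max_right _ _) h2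
      _ ≤ c₁' * (N : ℝ) ^ c₂' := mul_le_mul_of_nonneg_left h1 (by linarith)
  -- the bound for `G` on the box `1/2 ≤ Re s ≤ 7/2`, `|Im s| ≤ 3/2`
  set Bnd : ℝ := C * (5 / 2 : ℝ) ^ A * c₁' ^ A * (N : ℝ) ^ (A * c₂') with hBnd
  have hBnd0 : 0 ≤ Bnd := by rw [hBnd]; positivity
  have key : ∀ s : ℂ, 1 / 2 ≤ s.re → s.re ≤ 7 / 2 → |s.im| ≤ 3 / 2 → s ≠ 1 → ‖G s‖ ≤ Bnd := by
    intro s h1 h2 h3 h4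
    have hc := hconvD s h1 h2 h4
    rw [hm0, pow_zero, one_mul] at hc
    rw [hGF' s h4]
    refine hc.trans ?_
    have ht0 : 0 ≤ 1 + |s.im| := by linarith [abs_nonneg s.im]
    have h5 : (1 + |s.im|) ^ A ≤ (5 / 2 : ℝ) ^ A := Real.rpow_le_rpow ht0 (by linarith) hA
    have h6 : max 1 D.Q ^ A ≤ (c₁' * (N : ℝ) ^ c₂') ^ A :=
      Real.rpow_le_rpow (le_trans zero_le_one (le_max_left _ _)) hmax hA
    have h7 : (c₁' * (N : ℝ) ^ c₂') ^ A = c₁' ^ A * (N : ℝ) ^ (A * c₂') := by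
      rw [Real.mul_rpow (by linarith) (Real.rpow_nonneg hN0'.le _), ← Real.rpow_mul hN0'.le,
        mul_comm c₂' A]
    calc C * max 1 D.Q ^ A * (1 + |s.im|) ^ A
        ≤ C * (c₁' ^ A * (N : ℝ) ^ (A * c₂')) * (5 / 2 : ℝ) ^ A := by
          rw [← h7]
          exact mul_le_mul (mul_le_mul_of_nonneg_left h6 hC.le) h5 (Real.rpow_nonneg ht0 _)
            (by positivity)
      _ = Bnd := by rw [hBnd]; ring
  have hGbound : ∀ s : ℂ, 1 / 2 ≤ s.re → s.re ≤ 7 / 2 → |s.im| ≤ 3 / 2 → ‖G s‖ ≤ Bnd := by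
    intro s h1 h2 h3
    by_cases h4 : s = 1
    · -- continuity at `s = 1`
      subst h4
      have htend : Tendsto (fun z ↦ ‖G z‖) (𝓝[≠] (1 : ℂ)) (𝓝 ‖G 1‖) :=
        ((hG.continuous.continuousAt (x := (1 : ℂ))).norm.tendsto).mono_left nhdsWithin_le_nhds
      refine le_of_tendsto htend ?_
      have hball : ∀ᶠ z in 𝓝[≠] (1 : ℂ), z ∈ ball (1 : ℂ) (1 / 2) ∧ z ≠ 1 := by
        refine eventually_nhdsWithin_iff.mpr ?_
        have : ∀ᶠ z in 𝓝 (1 : ℂ), z ∈ ball (1 : ℂ) (1 / 2) := ball_mem_nhds _ (by norm_num)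
        exact this.mono fun z hz hne ↦ ⟨hz, hne⟩
      refine hball.mono fun z hz ↦ ?_
      obtain ⟨hz, hne⟩ := hz
      rw [mem_ball, dist_eq_norm] at hz
      have hre := abs_re_le_norm (z - 1)
      have him := abs_im_le_norm (z - 1)
      rw [sub_re, Complex.one_re] at hre
      rw [sub_im, Complex.one_im, sub_zero] at him
      have hre' := abs_le.mp (hre.trans hz.le)
      exact key z (by linarith [hre'.1]) (by linarith [hre'.2]) (by linarith) hne
    · exact key s h1 h2 h3 h4
  -- differentiability of the bad factors
  have hcpow : ∀ p ∈ N.primeFactors, Differentiable ℂ fun s : ℂ ↦ (p : ℂ) ^ (-s) := fun p hp ↦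
    differentiable_id.neg.const_cpow
      (Or.inl (Nat.cast_ne_zero.mpr (Nat.prime_of_mem_primeFactors hp).ne_zero))
  have hdiffB : Differentiable ℂ fun s : ℂ ↦
      ∏ p ∈ N.primeFactors, ∏ j : Fin 5, (1 - β p j * (p : ℂ) ^ (-s)) := by
    refine Differentiable.fun_finsetProd fun p hp ↦ ?_
    refine Differentiable.fun_finsetProd fun j _ ↦ ?_
    exact (differentiable_const _).sub ((differentiable_const _).mul (hcpow p hp))
  -- the entire function `L₄ = G · (bad factors)`
  refine ⟨fun s ↦ G s * ∏ p ∈ N.primeFactors, ∏ j : Fin 5, (1 - β p j * (p : ℂ) ^ (-s)),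
    hG.mul hdiffB, ?_, ?_⟩
  · intro s hs
    have hsum := Kim2003_symmFourL_nonCM_entire_polyBound.summable_logEuler N W f hf s hs
    refine ⟨hsum.1, hsum.2, ?_⟩
    have hs1 : s ≠ 1 := fun h ↦ by rw [h, Complex.one_re] at hs; exact lt_irrefl _ hs
    have hone : ∏ p ∈ N.primeFactors, ((∏ j : Fin 5, (1 - β p j * (p : ℂ) ^ (-s))⁻¹) *
        ∏ j : Fin 5, (1 - β p j * (p : ℂ) ^ (-s))) = 1 := by
      refine Finset.prod_eq_one fun p hp ↦ ?_
      rw [← Finset.prod_mul_distrib]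
      exact Finset.prod_eq_one fun j _ ↦ inv_mul_cancel₀
        (one_sub_badFactor_ne_zero (hβ p j) (Nat.prime_of_mem_primeFactors hp) (by linarith))
    show G s * ∏ p ∈ N.primeFactors, ∏ j : Fin 5, (1 - β p j * (p : ℂ) ^ (-s)) = _
    rw [hGF' s hs1, hEuler s hs, mul_assoc, ← Finset.prod_mul_distrib, hone, mul_one]
    rfl
  · intro s hs
    rw [mem_closedBall, dist_eq_norm] at hs
    have hre := abs_re_le_norm (s - 2)
    have him := abs_im_le_norm (s - 2)
    rw [sub_re, show (2 : ℂ).re = 2 from rfl] at hre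
    rw [sub_im, show (2 : ℂ).im = 0 from rfl, sub_zero] at him
    have hre' := abs_le.mp (hre.trans hs)
    have h1 : 1 / 2 ≤ s.re := by linarith [hre'.1]
    have h2 : s.re ≤ 7 / 2 := by linarith [hre'.2]
    have h3 : |s.im| ≤ 3 / 2 := him.trans hs
    show ‖G s * ∏ p ∈ N.primeFactors, ∏ j : Fin 5, (1 - β p j * (p : ℂ) ^ (-s))‖ ≤ _
    rw [norm_mul]
    have hN5 : (N : ℝ) ^ Kfin = (N : ℝ) ^ (A * c₂') * (N : ℝ) ^ 5 := by
      rw [hKfin, Real.rpow_add hN0', show (5 : ℝ) = ((5 : ℕ) : ℝ) by norm_num, Real.rpow_natCast]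
    have hCle : C * (5 / 2 : ℝ) ^ A * c₁' ^ A ≤ Cfin := le_max_right _ _
    calc ‖G s‖ * ‖∏ p ∈ N.primeFactors, ∏ j : Fin 5, (1 - β p j * (p : ℂ) ^ (-s))‖
        ≤ Bnd * (N : ℝ) ^ 5 :=
          mul_le_mul (hGbound s h1 h2 h3) (norm_prod_badFactor_le N hN0 hβ h1) (norm_nonneg _) hBnd0
      _ = (C * (5 / 2 : ℝ) ^ A * c₁' ^ A) * ((N : ℝ) ^ (A * c₂') * (N : ℝ) ^ 5) := by
          rw [hBnd]; ring
      _ ≤ Cfin * ((N : ℝ) ^ (A * c₂') * (N : ℝ) ^ 5) :=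
          mul_le_mul_of_nonneg_right hCle (by positivity)
      _ = Cfin * (N : ℝ) ^ Kfin := by rw [hN5]

end Literature.NumberTheory.Automorphic

end
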